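import Summits.Ventures.QEC.Census.CertCoverProducers
import Summits.Ventures.QEC.Census.CertCoverCosetD
import Summits.Ventures.QEC.Census.CertBZPlaneAllow
import Summits.Ventures.QEC.Census.CertBZPlaneSeg2
import Summits.Ventures.QEC.Census.BZAutPermFast
import HarnessLib

/-!
# Cover certificates with COMPACT data: level-1→0 problems built in the kernel, orbit witness tables generated in the
# kernel, allow-lists as filters (qec lane ε, type-10 assembly side; first consumer: the one-level certificate of the
# census row `A1s_n192_k4_0fa3ae82` = `[[192,4,18]]`, qec-search-1 `cover_A1s_n192_k4_Z_W16_v11g_1L.json`)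

The `[[288,12,18]]` closer (`Theorems/BB288DistanceCertificateCoverLowerZ`) consumed ≈ 170 data modules: every
LEVEL-1→0 coset problem shipped its re-systematised kernel rows `G`, completeness coefficients and `D`-selections
(`CosetProb` + `gD`/`bD`, ≈ 12 lines each), and the found list / witness table were shipped word by word. For the
A.1 cover rows (`[[192,4,18]]`: 1 233 problems, 58 474 found words) this file moves that bookkeeping INTO THE KERNEL —
nothing about the checks changes (the verdicts are still `cosetOKD`, `witnessOK`, `segOK`/`seg2OK` of the tree):
* `ProbData` — the irreducible data of one level-1→0 problem: `U` (the representative), depth `f`, target syndrome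
  `sigma`, ANY particular solution `y0`, the allow-list of outside parts; `mkCoset nq D d` ELIMINATES the kernel generator
  list `D` outside `U` (`elim`: greedy pivots, full reduction, `D`-selection words carried along) and returns the
  `CosetProb` (rows `G` systematic on the pivot columns `T ⊆ Ū`, inside-`U` rows `BU`, `y0` cleared on `T`, completeness
  coefficients read off the pivots) with its `gD`/`bD`; `probOK` = `cosetOKD` on it ∧ the fast target syndrome
  (`sigmaOfQ`) ∧ the depth inequality ∧ `buEvenOK` ∧ `labelCheckOK`; ★ `noBadOver_of_probOK` = T0
  (`noBadOver_of_levelLabel`) on the built problem, and `noBadOver_all_of_probsOK` for a list of problems;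
* `orbTab tr inv na reps` — the witness table of ALL `na` translates of the representatives under a kernel-cheap word
  map `tr i` (e.g. block rotations), entry `⟨tr i r_j, inv i, j⟩`; `orbCheck` re-checks every entry with type-12's
  lockstep `permWordL` against the tabulated permutations, and ★ `witnessOK_of_orbCheck` gives the tree's `witnessOK`
  (so `tr` needs NO semantics: a wrong `tr` fails the check); `coveredOK_orbWords` is `coveredOK` for its word list;
* `famHit` + `segOK_of_filter` / `seg2OK_of_filter` — replay a lane family against the SUB-list of a long allow-list
  selected by a mask predicate (monotonicity, `CertBZPlaneAllow`), so no straggler list is shipped either.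
HONEST FRAMING: generic glue; definitions + theorems, everything proved, nothing evaluated here; tier KERNEL, axioms
standard. No instances, no notation.
-/

namespace Summit.Ventures.QEC.Census

open Matrix Literature.InformationTheory.QuantumCodes

/-! ## Elimination with selection words carried along -/

/-- Remove the first pair whose word has bit `q`; `none` if there is none. (definition) -/
def pickBit (q : ℕ) : List (ℕ × ℕ) → Option ((ℕ × ℕ) × List (ℕ × ℕ))
  | [] => none
  | (r, cf) :: rest =>
    if r.testBit q then some ((r, cf), rest)
    else match pickBit q rest with
      | none => none
      | some (p, rest') => some (p, (r, cf) :: rest')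

/-- Clear bit `q` in every pair of a work list by the pivot pair `(pr, pc)`. (definition) -/
def reducePairs (q pr pc : ℕ) (L : List (ℕ × ℕ)) : List (ℕ × ℕ) :=
  L.map fun rc => if rc.1.testBit q then (rc.1 ^^^ pr, rc.2 ^^^ pc) else rc

/-- Clear bit `q` in every pivot triple `(row, coef, col)` by the pivot pair `(pr, pc)`. (definition) -/
def reducePivs (q pr pc : ℕ) (L : List (ℕ × ℕ × ℕ)) : List (ℕ × ℕ × ℕ) :=
  L.map fun t => if t.1.testBit q then (t.1 ^^^ pr, t.2.1 ^^^ pc, t.2.2) else t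

/-- Greedy elimination along the column list: returns the pivot triples `(row, coef, col)` (in pivot order, fully
reduced on the pivot columns) and the remaining pairs (zero on every listed column that got a pivot … and on the
others too, since no pair had that bit). (definition, structural on the column list) -/
def elim : List ℕ → List (ℕ × ℕ × ℕ) → List (ℕ × ℕ) → List (ℕ × ℕ × ℕ) × List (ℕ × ℕ)
  | [], piv, work => (piv, work)
  | q :: qs, piv, work =>
    match pickBit q work with
    | none => elim qs piv work
    | some ((pr, pc), rest) => elim qs (reducePivs q pr pc piv ++ [(pr, pc, q)]) (reducePairs q pr pc rest)

/-- Pair every word of a list with its unit selection word `2^i`. (definition) -/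
def unitPairs : List ℕ → ℕ → List (ℕ × ℕ)
  | [], _ => []
  | x :: xs, i => (x, 2 ^ i) :: unitPairs xs (i + 1)

/-! ## Level-1→0 problems from compact data -/

/-- The irreducible data of one LEVEL-1→0 coset problem: representative `U`, depth `f`, target syndrome `sigma`, a
particular solution `y0` (any), the allow-list of outside parts. -/
structure ProbData where
  /-- the representative `u` (= the fixed support `U`) -/
  U : ℕ
  /-- enumeration depth -/
  f : ℕ
  /-- target syndrome `σ(u)` -/
  sigma : ℕ
  /-- a particular solution of `Hq y = σ` -/
  y0 : ℕ
  /-- allow-list of outside parts -/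
  allow : List ℕ

/-- **The problem builder.** Eliminate `D` on the columns outside `U` (pivots `T`, rows `G`, `D`-selections `gD`),
then the inside-`U` remainders on the columns of `U` (rows `BU`, `D`-selections `bD`); clear `y0` on `T`; read the
completeness coefficients of every `D[i]` off the two pivot systems. Returns `(P, gD, bD)`. (definition) -/
def mkCoset (nq : ℕ) (D : List ℕ) (d : ProbData) : CosetProb × List ℕ × List ℕ :=
  let ubar := (List.range nq).filter fun q => !d.U.testBit q
  let uin := (List.range nq).filter fun q => d.U.testBit q
  let e1 := elim ubar [] (unitPairs D 0)
  let e2 := elim uin [] (e1.2.filter fun rc => !(rc.1 == 0))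
  let G := e1.1.map fun t => t.1
  let T := e1.1.map fun t => t.2.2
  let BU := e2.1.map fun t => t.1
  let TU := e2.1.map fun t => t.2.2
  let y0 := d.y0 ^^^ xorSel G (selOf T d.y0)
  ({ U := d.U, f := d.f, sigma := d.sigma, y0 := y0, T := T, G := G, BU := BU,
      coefG := D.map fun x => selOf T x,
      coefB := D.map fun x => selOf TU (x ^^^ xorSel G (selOf T x)),
      allow := d.allow },
    e1.1.map (fun t => t.2.1), e2.1.map (fun t => t.2.1))

/-- **The per-problem verdict**: `cosetOKD` on the built problem, the target syndrome by the fast twin `sigmaOfQ`,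
the depth inequality `W ≤ 2f + |U|`, the `BU`-evenness of the dual words and the label check of every allow-listed
solution. (definition, `decide +kernel`) -/
def probOK (c cr : Cover2) (HX Hq D LXd : List ℕ) (W : ℕ) (d : ProbData) : Bool :=
  let r := mkCoset c.nq D d
  cosetOKD c.nq Hq D r.1 r.2.1 r.2.2 && (sigmaOfQ c cr HX d.U == d.sigma) &&
    decide (W ≤ 2 * d.f + popc c.nq d.U) && buEvenOK c r.1 LXd && labelCheckOK c r.1 d.U LXd

/-- All problems of a list pass. (definition) -/
def probsOK (c cr : Cover2) (HX Hq D LXd : List ℕ) (W : ℕ) (L : List ProbData) : Bool :=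
  L.all fun d => probOK c cr HX Hq D LXd W d

/-- The built problem keeps the representative. -/
theorem mkCoset_U (nq : ℕ) (D : List ℕ) (d : ProbData) : (mkCoset nq D d).1.U = d.U := rfl

section Sound

variable {c cr : Cover2} {HX HZ Hq D LXd : List ℕ} {W k : ℕ}

/-- ★ **T0 on a built problem**: a passing `probOK` (with the level's standing hypotheses: cover tables, row table,
`ker Hq ⊆ span D`, `D ⊆ ker Hq`, L1 upstairs in label form) gives `NoBadOver … W d.U`. -/
theorem noBadOver_of_probOK (hc : c.ok = true) (hcr : cr.ok = true) (hrows : pushRowsOK c cr HX Hq = true)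
    (hDq : ∀ z : Fin c.nq → ZMod 2, rowMatrix c.nq Hq *ᵥ z = 0 →
      z ∈ Submodule.span (ZMod 2) (Set.range fun i : Fin D.length => ofBits c.nq D[i]))
    (hDker : (D.all fun x => synZero c.nq Hq x) = true) (hk : LXd.length = k)
    (hLab : ∀ v : ℕ, synZero c.n HX v = true → (∀ i : ℕ, i < k → popc c.n (LXd.getD i 0 &&& v) % 2 = 0) →
      ofBits c.n v ∈ rowSpace (rowMatrix c.n HZ))
    (hn : c.n ≤ 496) {d : ProbData} (h : probOK c cr HX Hq D LXd W d = true) :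
    NoBadOver c HX HZ W d.U := by
  unfold probOK at h
  simp only [Bool.and_eq_true, beq_iff_eq, decide_eq_true_eq] at h
  obtain ⟨⟨⟨⟨hcos, hsig⟩, hf⟩, hbu⟩, hlab⟩ := h
  exact noBadOver_of_levelLabel hc hcr hrows hDq (cosetOK_of_cosetOKD hDker hcos) (mkCoset_U c.nq D d)
    (sigma_eq_of_Q hn hsig) hf hbu hlab hk hLab

/-- ★ **All problems of a list**: the indexed `hreps` form of T1 over the representatives `L.map ProbData.U`. -/
theorem noBadOver_all_of_probsOK (hc : c.ok = true) (hcr : cr.ok = true) (hrows : pushRowsOK c cr HX Hq = true)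
    (hDq : ∀ z : Fin c.nq → ZMod 2, rowMatrix c.nq Hq *ᵥ z = 0 →
      z ∈ Submodule.span (ZMod 2) (Set.range fun i : Fin D.length => ofBits c.nq D[i]))
    (hDker : (D.all fun x => synZero c.nq Hq x) = true) (hk : LXd.length = k)
    (hLab : ∀ v : ℕ, synZero c.n HX v = true → (∀ i : ℕ, i < k → popc c.n (LXd.getD i 0 &&& v) % 2 = 0) →
      ofBits c.n v ∈ rowSpace (rowMatrix c.n HZ))
    (hn : c.n ≤ 496) {L : List ProbData} (h : probsOK c cr HX Hq D LXd W L = true) :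
    ∀ u ∈ L.map ProbData.U, NoBadOver c HX HZ W u := by
  intro u hu
  rw [List.mem_map] at hu
  obtain ⟨d, hd, rfl⟩ := hu
  simp only [probsOK, List.all_eq_true] at h
  exact noBadOver_of_probOK hc hcr hrows hDq hDker hk hLab hn (h d hd)

end Sound

/-! ## Orbit witness tables generated in the kernel -/

/-- The witness entries of one representative `r` (index `j`): `⟨tr i r, inv i, j⟩` for `i < na`. (definition) -/
def orbRow (tr : ℕ → ℕ → ℕ) (inv : ℕ → ℕ) (na r j : ℕ) : List CoverWitness :=
  (List.range na).map fun i => ⟨tr i r, inv i, j⟩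

/-- The witness table of all representatives, walking the list with its index. (definition) -/
def orbTabAux (tr : ℕ → ℕ → ℕ) (inv : ℕ → ℕ) (na : ℕ) : List ℕ → ℕ → List CoverWitness
  | [], _ => []
  | r :: rs, j => orbRow tr inv na r j ++ orbTabAux tr inv na rs (j + 1)

/-- **The orbit witness table** of `reps` under the `na` word maps `tr i` with inverse-index map `inv`. (definition) -/
def orbTab (tr : ℕ → ℕ → ℕ) (inv : ℕ → ℕ) (na : ℕ) (reps : List ℕ) : List CoverWitness := orbTabAux tr inv na reps 0

/-- Its word list (the candidate / allow list of the one-level certificate). (definition) -/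
def orbWords (tr : ℕ → ℕ → ℕ) (inv : ℕ → ℕ) (na : ℕ) (reps : List ℕ) : List ℕ :=
  (orbTab tr inv na reps).map CoverWitness.w

/-- **The round-trip check** of the table, with type-12's lockstep transport: for every representative `r` and every
`i < na`, `inv i` indexes a listed permutation and `permWordL permqs[inv i] (tr i r) = r`. (definition, `decide +kernel`) -/
def orbCheckAux (permqs : List (List ℕ)) (tr : ℕ → ℕ → ℕ) (inv : ℕ → ℕ) (na : ℕ) : List ℕ → Bool
  | [] => true
  | r :: rs =>
    ((List.range na).all fun i =>
      decide (inv i < permqs.length) && (permWordL (permqs.getD (inv i) []) (tr i r) == r)) &&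
      orbCheckAux permqs tr inv na rs

/-- The round-trip check of `orbTab tr inv na reps` against `permqs`. (definition) -/
def orbCheck (permqs : List (List ℕ)) (tr : ℕ → ℕ → ℕ) (inv : ℕ → ℕ) (na : ℕ) (reps : List ℕ) : Bool :=
  orbCheckAux permqs tr inv na reps

section Orbit

variable {tr : ℕ → ℕ → ℕ} {inv : ℕ → ℕ} {na : ℕ}

/-- Entries of the indexed walk: a translate of a listed representative, with its offset index. -/
theorem mem_orbTabAux {t : CoverWitness} : ∀ (rs : List ℕ) (j0 : ℕ), t ∈ orbTabAux tr inv na rs j0 →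
    ∃ i, i < na ∧ ∃ j, j < rs.length ∧ t = ⟨tr i (rs.getD j 0), inv i, j0 + j⟩
  | [], _, h => by simp [orbTabAux] at h
  | r :: rs, j0, h => by
    rw [orbTabAux, List.mem_append] at h
    rcases h with h | h
    · simp only [orbRow, List.mem_map, List.mem_range] at h
      obtain ⟨i, hi, rfl⟩ := h
      exact ⟨i, hi, 0, Nat.succ_pos _, by simp⟩
    · obtain ⟨i, hi, j, hj, rfl⟩ := mem_orbTabAux rs (j0 + 1) h
      refine ⟨i, hi, j + 1, Nat.succ_lt_succ hj, ?_⟩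
      simp only [List.getD_cons_succ, CoverWitness.mk.injEq, true_and]
      omega

/-- The walk's check, read at an index. -/
theorem orbCheckAux_get {permqs : List (List ℕ)} : ∀ (rs : List ℕ), orbCheckAux permqs tr inv na rs = true →
    ∀ j, j < rs.length → ∀ i, i < na →
      inv i < permqs.length ∧ permWordL (permqs.getD (inv i) []) (tr i (rs.getD j 0)) = rs.getD j 0
  | [], _, j, hj, _, _ => absurd hj (Nat.not_lt_zero _)
  | r :: rs, h, j, hj, i, hi => by
    rw [orbCheckAux, Bool.and_eq_true] at h
    obtain ⟨hrow, hrest⟩ := h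
    cases j with
    | zero =>
      simp only [List.all_eq_true, List.mem_range, Bool.and_eq_true, decide_eq_true_eq, beq_iff_eq] at hrow
      simpa using hrow i hi
    | succ j =>
      simpa using orbCheckAux_get rs hrest j (Nat.lt_of_succ_lt_succ hj) i hi

/-- ★ **`witnessOK` of the generated table from the round-trip check** (each listed `permqs[i]` a valid table). -/
theorem witnessOK_of_orbCheck {nq : ℕ} {permqs : List (List ℕ)} {reps : List ℕ}
    (hperm : ∀ i : ℕ, i < permqs.length → permListOK nq (permqs.getD i []) = true)
    (h : orbCheck permqs tr inv na reps = true) : witnessOK nq permqs reps (orbTab tr inv na reps) = true := by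
  simp only [witnessOK, List.all_eq_true, Bool.and_eq_true, decide_eq_true_eq, beq_iff_eq]
  intro t ht
  obtain ⟨i, hi, j, hj, rfl⟩ := mem_orbTabAux reps 0 ht
  obtain ⟨hinv, hrt⟩ := orbCheckAux_get reps h j hj i hi
  refine ⟨⟨hinv, by simpa using hj⟩, ?_⟩
  simp only [Nat.zero_add]
  rw [← permWordL_eq_of_permListOK (hperm _ hinv)]
  exact hrt

/-- `coveredOK` of the word list by its own table. -/
theorem coveredOK_orbWords (reps : List ℕ) : coveredOK (orbWords tr inv na reps) (orbTab tr inv na reps) = true :=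
  coveredOK_of_map_eq rfl

end Orbit

/-! ## Lane families against a filtered allow-list -/

/-- Family hit predicate by masks: no bit in `mZero`, some bit in `mTop`, some bit in `mMid`. (definition) -/
def famHit (mZero mTop mMid w : ℕ) : Bool :=
  (Nat.land w mZero == 0) && !(Nat.land w mTop == 0) && !(Nat.land w mMid == 0)

/-- A segment replayed against a filtered allow-list holds for the whole list. -/
theorem segOK_of_filter {n wmax : ℕ} {allow : List ℕ} {p : ℕ → Bool} {G : List ℕ} {t m0 s fuel : ℕ}
    (h : Plane.segOK n wmax (allow.filter p) G t m0 s fuel = true) : Plane.segOK n wmax allow G t m0 s fuel = true :=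
  Plane.segOK_mono_allow (fun _ hw => (List.mem_filter.1 hw).1) h

/-- A second-row family replayed against a filtered allow-list holds for the whole list. -/
theorem seg2OK_of_filter {n wmax : ℕ} {allow : List ℕ} {p : ℕ → Bool} {G : List ℕ} {t m p0 q fuel : ℕ}
    (h : Plane.seg2OK n wmax (allow.filter p) G t m p0 q fuel = true) :
    Plane.seg2OK n wmax allow G t m p0 q fuel = true :=
  Plane.familyOK_mono_allow (fun _ hw => (List.mem_filter.1 hw).1) h

/-! ## Controls (`decide`) -/

/-- The toy of `CertCoverCoset`/`CertCoverCosetD` rebuilt from compact data: system `[15]` on 4 bits, `D = [3,5,9]`,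
`U = 0b0011`, target `1`, particular solution `0b0001`: the builder's problem passes `cosetOKD` with its own `gD`/`bD`. -/
theorem mkCoset_toy : (cosetOKD 4 [15] [3, 5, 9] (mkCoset 4 [3, 5, 9] ⟨3, 1, 1, 1, [0, 4, 8]⟩).1
    (mkCoset 4 [3, 5, 9] ⟨3, 1, 1, 1, [0, 4, 8]⟩).2.1 (mkCoset 4 [3, 5, 9] ⟨3, 1, 1, 1, [0, 4, 8]⟩).2.2) = true := by
  decide

/-- The orbit table of the two representatives `[1, 6]` under the two maps «identity», «swap bits 0,1 and 2,3»
(tables `[[0,1,2,3],[1,0,3,2]]`, self-inverse) passes the round trip, and a wrong inverse map is caught. -/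
theorem orbCheck_control :
    orbCheck [[0, 1, 2, 3], [1, 0, 3, 2]] (fun i w => if i = 0 then w else permWordL [1, 0, 3, 2] w) (fun i => i) 2 [1, 6]
      = true ∧
    orbCheck [[0, 1, 2, 3], [1, 0, 3, 2]] (fun i w => if i = 0 then w else permWordL [1, 0, 3, 2] w) (fun _ => 0) 2 [1, 6]
      = false := by
  constructor <;> decide

end Summit.Ventures.QEC.Census
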